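import Literature.RingTheory.TightClosure.TightClosure
import HarnessLib

/-!
# Exchange step for tight closure (crux `FrobeniusLadder.FRationalResolution`, line `Sketch`)

Stub `stub_tc_exchange` of the skeleton `Sketch` for crux stmt-ResolutionOfSingularities-15317 (theme:
"in a Cohen–Macaulay local ring ONE tightly closed parameter ideal makes ALL parameter ideals tightly
closed", the Cohen–Macaulay case of [HochsterHuneke1994, Thm. 4.2 (d)], by an elementary exchange chain
between two systems of parameters).

Setting.  `R` is a commutative ring of prime characteristic `p`, `J` an ideal, `a g w j : R`, `M : ℕ`
with `j ∈ J`, `a ^ M = w * g + j` (so `a ^ M ∈ (J, g)`), `a` a non-zero-divisor modulo `J`, and the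
ideal `(J, a ^ M)` tightly closed.  We prove that `(J, g)` is tightly closed.

Proof.  Let `u ∈ (J, g)^*` with witness `c ∈ R°`: `c u^q ∈ (J, g)^[q] = J^[q] + (g^q)` for
`q = p^e ≫ 0`.  Multiplying by `w^q` and using `g^q w^q = (w g)^q = (a^M - j)^q = (a^M)^q - j^q` with
`j^q ∈ J^[q]` gives `c (u w)^q ∈ J^[q] + ((a^M)^q) = (J, a^M)^[q]`, so `u w ∈ (J, a^M)^* = (J, a^M)`:
`u w = j' + r a^M = j' + r (w g + j)`, i.e. `w (u - r g) = j' + r j ∈ J`.  Since `w` is a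
non-zero-divisor modulo `J` (if `z w ∈ J` then `z a^M = z w g + z j ∈ J`, hence `z ∈ J` by applying the
hypothesis on `a` `M` times), `u - r g ∈ J` and `u ∈ (J, g)`.
-/

set_option linter.dupNamespace false

open IsLocalRing Literature.RingTheory.TightClosure

namespace Summit.ResolutionOfSingularities.ResolutionOfSingularities.Theorems.FRationalResolution

/-- Frobenius powers commute with adjoining one generator:
`(I + (b))^[p^e] = I^[p^e] + (b^(p^e))`. -/
theorem frobeniusPower_sup_span_singleton {R : Type} [CommRing R] (p : ℕ) [ExpChar R p] (e : ℕ)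
    (I : Ideal R) (b : R) :
    frobeniusPower (p ^ e) (I ⊔ Ideal.span {b}) =
      frobeniusPower (p ^ e) I ⊔ Ideal.span {b ^ p ^ e} := by
  rw [frobeniusPower_eq_map_iterateFrobenius, frobeniusPower_eq_map_iterateFrobenius, Ideal.map_sup,
    Ideal.map_span, Set.image_singleton, iterateFrobenius_def]

/-- If `a` is a non-zero-divisor modulo the ideal `J` (`z a ∈ J ⇒ z ∈ J`), then so is every power
`a ^ n`. -/
theorem mem_of_mul_pow_mem {R : Type} [CommRing R] (J : Ideal R) (a : R)
    (ha : ∀ z : R, z * a ∈ J → z ∈ J) (n : ℕ) (z : R) (hz : z * a ^ n ∈ J) : z ∈ J := by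
  induction n generalizing z with
  | zero => simpa using hz
  | succ n ih =>
    refine ih z (ha _ ?_)
    rwa [mul_assoc, ← pow_succ]

/-- **Exchange step for tight closure.**  Let `R` be a commutative ring of prime characteristic `p`,
`J` an ideal, `j ∈ J`, `a ^ M = w * g + j`, `a` a non-zero-divisor modulo `J`, and suppose the ideal
`(J, a ^ M)` is tightly closed.  Then `(J, g)` is tightly closed: for `u ∈ (J, g)^*` one has
`u w ∈ (J, a^M)^* = (J, a^M)` (multiply the tight closure equations by `w^q` and use
`(w g)^q = (a^M)^q - j^q`), whence `w (u - r g) ∈ J` for some `r`, and `w` is a non-zero-divisor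
modulo `J` because `a ^ M = w g + j` is.  [cite: HochsterHuneke1994, Thm. 4.2 (d) (proof, exchange
step)] -/
theorem stub_tc_exchange (p : ℕ) [Fact p.Prime] (R : Type) [CommRing R] [CharP R p]
    (J : Ideal R) (a g w j : R) (M : ℕ) (hj : j ∈ J) (haM : a ^ M = w * g + j)
    (ha : ∀ z : R, z * a ∈ J → z ∈ J)
    (htc : Literature.RingTheory.TightClosure.IsTightlyClosed p (J ⊔ Ideal.span {a ^ M})) :
    Literature.RingTheory.TightClosure.IsTightlyClosed p (J ⊔ Ideal.span {g}) := by
  -- `w` is a non-zero-divisor modulo `J`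
  have hw : ∀ z : R, z * w ∈ J → z ∈ J := by
    intro z hzw
    refine mem_of_mul_pow_mem J a ha M z ?_
    rw [haM, mul_add, ← mul_assoc]
    exact J.add_mem (J.mul_mem_right _ hzw) (J.mul_mem_left _ hj)
  -- `w * g = a ^ M - j`
  have hwg : w * g = a ^ M - j := eq_sub_of_add_eq haM.symm
  rw [isTightlyClosed_iff_le]
  intro u hu
  obtain ⟨c, hc, e₀, he⟩ := (mem_tightClosure_iff p).mp hu
  -- `u * w ∈ (J, a^M)^* = (J, a^M)`
  have huw : u * w ∈ tightClosure p (J ⊔ Ideal.span {a ^ M}) := by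
    refine (mem_tightClosure_iff p).mpr ⟨c, hc, e₀, fun e hee => ?_⟩
    have h1 := he e hee
    rw [frobeniusPower_sup_span_singleton p e, Submodule.mem_sup] at h1
    obtain ⟨y, hy, t, ht, hyt⟩ := h1
    obtain ⟨s, rfl⟩ := Ideal.mem_span_singleton'.mp ht
    rw [frobeniusPower_sup_span_singleton p e, mul_pow, ← mul_assoc, ← hyt]
    -- `(y + s * g^q) * w^q = y * w^q - s * j^q + s * (a^M)^q`
    have key : (y + s * g ^ p ^ e) * w ^ p ^ e =
        (y * w ^ p ^ e - s * j ^ p ^ e) + s * (a ^ M) ^ p ^ e := by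
      have h2 : g ^ p ^ e * w ^ p ^ e = (a ^ M) ^ p ^ e - j ^ p ^ e := by
        rw [← mul_pow, mul_comm g w, hwg, sub_pow_expChar_pow]
      rw [add_mul, mul_assoc, h2]
      ring
    rw [key]
    refine Submodule.add_mem_sup (Ideal.sub_mem _ (Ideal.mul_mem_right _ _ hy)
      (Ideal.mul_mem_left _ _ (pow_mem_frobeniusPower hj))) (Ideal.mul_mem_left _ _ ?_)
    exact Ideal.mem_span_singleton_self _
  have huw' : u * w ∈ J ⊔ Ideal.span {a ^ M} := htc.le huw
  rw [Submodule.mem_sup] at huw'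
  obtain ⟨j', hj', t, ht, hjt⟩ := huw'
  obtain ⟨r, rfl⟩ := Ideal.mem_span_singleton'.mp ht
  -- `w * (u - r * g) = j' + r * j ∈ J`
  have hdiff : u - r * g ∈ J := by
    refine hw _ ?_
    have h3 : (u - r * g) * w = j' + r * j := by
      have h4 : j' + r * a ^ M = u * w := hjt
      rw [haM] at h4
      linear_combination -h4
    rw [h3]
    exact J.add_mem hj' (J.mul_mem_left _ hj)
  have hu' : u = (u - r * g) + r * g := by ring
  rw [hu']
  exact Submodule.add_mem_sup hdiff (Ideal.mem_span_singleton'.mpr ⟨r, rfl⟩)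

end Summit.ResolutionOfSingularities.ResolutionOfSingularities.Theorems.FRationalResolution
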